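import Mathlib
import Summits.Ventures.PercRepro2.Defs
import Summits.Ventures.PercRepro2.Harris
import Summits.Ventures.PercRepro2.Graph
import Summits.Ventures.PercRepro2.Events
import Summits.Ventures.PercRepro2.Induced
import Summits.Ventures.PercRepro2.BHKEvents
import Summits.Ventures.PercRepro2.BHKAvoid
import Summits.Ventures.PercRepro2.BHKAvoidWeighted

/-!
# The core case (Ψ-sub′) of the (PM⁺) line and its two-up-set form (GEN-sub) (PercRepro2, p2)

Roles `s = a₂`, `t = a₁` (`C_s = H`, `C_t = L`), `Q = {s ↮ t}`, `μ = P(· | Q)`; a vertex `o`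
has one of three statuses under `μ`: `o ∈ H`, `o ∈ L`, or `o ∈ N` (neither).  For up-sets
`𝓤 ⊆ 𝓥` of `H`-clusters the seat's conjecture of record (proofs/P2-G16-GENSUB.md) is

  **(GEN-sub)**  `μ(o ∈ L | H ∈ 𝓤) + μ(o ∈ H) ≤ μ(o ∈ L ∪ H | H ∈ 𝓥)`,

equivalently `μ(o ∈ L | 𝓤) − μ(o ∈ L | 𝓥) ≤ μ(o ∈ H | 𝓥) − μ(o ∈ H)`: conditioning the law of
`H` on a SMALLER up-set can raise `μ(o ∈ L)` (the Berkson effect of the contain-conditioned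
cluster laws, P2-G15-GENPLUS.md §5–§6, §9) by at most the positive-association lift of
`{o ∈ H}` under the larger up-set.  Its case `𝓥 = {u ∈ ·}` is the core case (Ψ-sub′) of
P2-G15-GENPLUS.md §9.  Both are census-true (exact max-closure over ALL up-sets `𝓤 ⊆ 𝓥`;
abstract positive association does not suffice — the product-measure analogue is false).

This file fixes the two statements in the tree's vocabulary (multiplied out: `q = P(Q)`,
`oL = P(o ∈ C_t, Q)`, `oH = P(o ∈ C_s, Q)`, `U = P(C_s ∈ 𝓤, Q)`, `V = P(C_s ∈ 𝓥, Q)`,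
`oLU = P(C_s ∈ 𝓤, o ∈ C_t, Q)`, `oLV, oHV` likewise for `𝓥`) and proves two reductions:

* `genSub_of_cov_nonneg` — (GEN-sub) holds (for EVERY up-set `𝓤`, not only `𝓤 ⊆ 𝓥`) on every
  instance with `Cov_μ(1[o ∈ C_s ∪ C_t], 1[C_s ∈ 𝓥]) ≥ 0` (`(oL + oH)·V ≤ (oLV + oHV)·q`):
  the cross-cluster instance `bhk_cross_cluster` (`oLU·q ≤ U·oL`, BHK06 Thm 1.4) and the
  hypothesis.  This isolates the obstruction: the covariance hypothesis FAILS on some instances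
  (exact: 10 / 200 random instances at `n ≤ 6`), and there (GEN-sub) needs more than BHK;
* `psiSub_of_cov_nonneg` — the same for (Ψ-sub′) (`𝓥 = {u ∈ ·}`, `{C_s ∈ 𝓥} = {s ↔ u}`);
* `psi_of_psiSub` — the (Ψ)-form of (GEN+) (P2-G15-GENPLUS.md §0, (1.3)) restricted to up-sets
  `𝓤 ⊆ {u ∈ ·}` follows from the (Ψ-sub′) inequality for `𝓤` and `bhk_cross_cluster`: the (Ψ)
  bound `(1 − α)·μ(o ∈ L) + α·R` (`α = μ(u ∈ H)`, `R = μ(o ∈ L ∪ H | u ∈ H) − μ(o ∈ H)`) is a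
  convex combination of the (Ψ-sub′) bound `R` and the cross-cluster bound `μ(o ∈ L)`.
  So (Ψ-sub′) is the stronger statement on the sub-up-sets of `{u ∈ ·}`.
-/

namespace Summit.Ventures.PercRepro2

section GenSubCov

variable {V : Type*} {E : Type*} [Fintype E] [DecidableEq E] [Fintype V] [DecidableEq V]
  {R : Type*} [CommRing R] [LinearOrder R] [IsStrictOrderedRing R]

omit [Fintype E] [DecidableEq E] [Fintype V] [DecidableEq V] in
/-- The algebra of (GEN-sub) under the covariance hypothesis: from the cross-cluster instance
`oLU·q ≤ U·oL` and `(oL + oH)·V ≤ oUV·q`, with `U, V ≥ 0`,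
`oLU·q·V + oH·U·V ≤ oUV·q·U` (the multiplied-out form of
`oLU/U + oH/q ≤ oUV/V`). -/
lemma genSub_algebra {q U V oL oH oLU oUV : R} (hU : 0 ≤ U) (hV : 0 ≤ V)
    (h1 : oLU * q ≤ U * oL) (h2 : (oL + oH) * V ≤ oUV * q) :
    oLU * q * V + oH * U * V ≤ oUV * q * U := by
  have a := mul_le_mul_of_nonneg_right h1 hV
  have b := mul_le_mul_of_nonneg_left h2 hU
  nlinarith [a, b]

omit [Fintype E] [DecidableEq E] [Fintype V] [DecidableEq V] in
/-- The algebra of `psi_of_psiSub`: from `aH ≤ q`, the cross-cluster instance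
`oLU·q ≤ Ug·oL` and the (Ψ-sub′) inequality `oLU·q·aH + oH·Ug·aH ≤ (oLH + oHH)·q·Ug`,
`oLU·q² ≤ Ug·((q − aH)·oL + q·(oLH + oHH) − aH·oH)` (the (Ψ) inequality on `𝓤`,
multiplied out). -/
lemma psi_algebra {q aH Ug oL oH oLU oLH oHH : R} (hqa : aH ≤ q)
    (h1 : oLU * q ≤ Ug * oL) (h2 : oLU * q * aH + oH * Ug * aH ≤ (oLH + oHH) * q * Ug) :
    oLU * q * q ≤ Ug * ((q - aH) * oL + q * (oLH + oHH) - aH * oH) := by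
  have a := mul_le_mul_of_nonneg_right h1 (sub_nonneg.2 hqa)
  nlinarith [a, h2]

/-- **(GEN-sub) from the covariance hypothesis.** For up-sets `𝓤, 𝓥` of `C_s`-clusters and a
vertex `o`: if `Cov_μ(1[o ∈ C_s ∪ C_t], 1[C_s ∈ 𝓥]) ≥ 0`, multiplied out as
`(P(o ∈ C_t, Q) + P(o ∈ C_s, Q))·P(C_s ∈ 𝓥, Q) ≤ (P(C_s ∈ 𝓥, o ∈ C_t, Q) + P(C_s ∈ 𝓥, o ∈ C_s, Q))·P(Q)`,
then `μ(o ∈ C_t | C_s ∈ 𝓤) + μ(o ∈ C_s) ≤ μ(o ∈ C_s ∪ C_t | C_s ∈ 𝓥)`, multiplied out as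
`P(C_s ∈ 𝓤, o ∈ C_t, Q)·P(Q)·P(C_s ∈ 𝓥, Q) + P(o ∈ C_s, Q)·P(C_s ∈ 𝓤, Q)·P(C_s ∈ 𝓥, Q)
  ≤ (P(C_s ∈ 𝓥, o ∈ C_t, Q) + P(C_s ∈ 𝓥, o ∈ C_s, Q))·P(Q)·P(C_s ∈ 𝓤, Q)`.
The proof is the cross-cluster instance `bhk_cross_cluster` for `(𝓤, {o ∈ ·})` and the
hypothesis; `𝓤 ⊆ 𝓥` is not needed here (it is where the conjecture lives without the
hypothesis). -/
theorem genSub_of_cov_nonneg (p : E → R) (hp : IsProbVec p) (ends : E → Sym2 V) (s t o : V)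
    {𝓤 𝓥 : Set (Set V)} (h𝓤 : IsUpperSet 𝓤)
    (hcov : (prob p (clusterInEvent ends t {W : Set V | o ∈ W} ∩ (connEvent ends s t)ᶜ) +
          prob p (clusterInEvent ends s {W : Set V | o ∈ W} ∩ (connEvent ends s t)ᶜ)) *
        prob p (clusterInEvent ends s 𝓥 ∩ (connEvent ends s t)ᶜ) ≤
      (prob p (clusterInEvent ends s 𝓥 ∩ clusterInEvent ends t {W : Set V | o ∈ W} ∩
          (connEvent ends s t)ᶜ) +
        prob p (clusterInEvent ends s 𝓥 ∩ clusterInEvent ends s {W : Set V | o ∈ W} ∩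
          (connEvent ends s t)ᶜ)) * prob p (connEvent ends s t)ᶜ) :
    prob p (clusterInEvent ends s 𝓤 ∩ clusterInEvent ends t {W : Set V | o ∈ W} ∩
          (connEvent ends s t)ᶜ) * prob p (connEvent ends s t)ᶜ *
        prob p (clusterInEvent ends s 𝓥 ∩ (connEvent ends s t)ᶜ) +
      prob p (clusterInEvent ends s {W : Set V | o ∈ W} ∩ (connEvent ends s t)ᶜ) *
        prob p (clusterInEvent ends s 𝓤 ∩ (connEvent ends s t)ᶜ) *
        prob p (clusterInEvent ends s 𝓥 ∩ (connEvent ends s t)ᶜ) ≤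
      (prob p (clusterInEvent ends s 𝓥 ∩ clusterInEvent ends t {W : Set V | o ∈ W} ∩
          (connEvent ends s t)ᶜ) +
        prob p (clusterInEvent ends s 𝓥 ∩ clusterInEvent ends s {W : Set V | o ∈ W} ∩
          (connEvent ends s t)ᶜ)) * prob p (connEvent ends s t)ᶜ *
        prob p (clusterInEvent ends s 𝓤 ∩ (connEvent ends s t)ᶜ) := by
  have h1 := bhk_cross_cluster p hp ends s t h𝓤 (isUpperSet_memFamily o)
  exact genSub_algebra (prob_nonneg hp _) (prob_nonneg hp _) h1 hcov

/-- **(Ψ-sub′) from the covariance hypothesis** (P2-G15-GENPLUS.md §9): the case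
`𝓥 = {u ∈ ·}` of `genSub_of_cov_nonneg`, with `{C_s ∈ 𝓥} = {s ↔ u}`: if
`Cov_μ(1[o ∈ C_s ∪ C_t], 1[u ∈ C_s]) ≥ 0` then for every up-set `𝓤`,
`μ(o ∈ C_t | C_s ∈ 𝓤) + μ(o ∈ C_s) ≤ μ(o ∈ C_s ∪ C_t | u ∈ C_s)` (both multiplied out). -/
theorem psiSub_of_cov_nonneg (p : E → R) (hp : IsProbVec p) (ends : E → Sym2 V) (s t o u : V)
    {𝓤 : Set (Set V)} (h𝓤 : IsUpperSet 𝓤)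
    (hcov : (prob p (clusterInEvent ends t {W : Set V | o ∈ W} ∩ (connEvent ends s t)ᶜ) +
          prob p (clusterInEvent ends s {W : Set V | o ∈ W} ∩ (connEvent ends s t)ᶜ)) *
        prob p (connEvent ends s u ∩ (connEvent ends s t)ᶜ) ≤
      (prob p (connEvent ends s u ∩ clusterInEvent ends t {W : Set V | o ∈ W} ∩
          (connEvent ends s t)ᶜ) +
        prob p (connEvent ends s u ∩ clusterInEvent ends s {W : Set V | o ∈ W} ∩
          (connEvent ends s t)ᶜ)) * prob p (connEvent ends s t)ᶜ) :
    prob p (clusterInEvent ends s 𝓤 ∩ clusterInEvent ends t {W : Set V | o ∈ W} ∩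
          (connEvent ends s t)ᶜ) * prob p (connEvent ends s t)ᶜ *
        prob p (connEvent ends s u ∩ (connEvent ends s t)ᶜ) +
      prob p (clusterInEvent ends s {W : Set V | o ∈ W} ∩ (connEvent ends s t)ᶜ) *
        prob p (clusterInEvent ends s 𝓤 ∩ (connEvent ends s t)ᶜ) *
        prob p (connEvent ends s u ∩ (connEvent ends s t)ᶜ) ≤
      (prob p (connEvent ends s u ∩ clusterInEvent ends t {W : Set V | o ∈ W} ∩
          (connEvent ends s t)ᶜ) +
        prob p (connEvent ends s u ∩ clusterInEvent ends s {W : Set V | o ∈ W} ∩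
          (connEvent ends s t)ᶜ)) * prob p (connEvent ends s t)ᶜ *
        prob p (clusterInEvent ends s 𝓤 ∩ (connEvent ends s t)ᶜ) := by
  have hU : clusterInEvent ends s {W : Set V | u ∈ W} = connEvent ends s u :=
    clusterInEvent_memFamily_eq_connEvent ends s u
  have key := genSub_of_cov_nonneg p hp ends s t o (𝓥 := {W : Set V | u ∈ W}) h𝓤
    (by rw [hU]; exact hcov)
  rw [hU] at key
  exact key

/-- **(Ψ) on the sub-up-sets of `{u ∈ ·}` from (Ψ-sub′)** (P2-G15-GENPLUS.md §0, (1.3), §9).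
For an up-set `𝓤` (meant `⊆ {u ∈ ·}`; the algebra does not need it), the (Ψ-sub′) inequality
`P(C_s ∈ 𝓤, o ∈ C_t, Q)·P(Q)·P(u ∈ C_s, Q) + P(o ∈ C_s, Q)·P(C_s ∈ 𝓤, Q)·P(u ∈ C_s, Q)
  ≤ (P(u ∈ C_s, o ∈ C_t, Q) + P(u ∈ C_s, o ∈ C_s, Q))·P(Q)·P(C_s ∈ 𝓤, Q)`
implies the (Ψ) inequality on `𝓤`, i.e. `Cov_ν(ψ, 1_𝓤) ≤ 0` for `𝓤 ⊆ {u ∈ ·}`, multiplied out as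
`P(C_s ∈ 𝓤, o ∈ C_t, Q)·P(Q)² ≤ P(C_s ∈ 𝓤, Q)·((P(Q) − P(u ∈ C_s, Q))·P(o ∈ C_t, Q)
  + P(Q)·(P(u ∈ C_s, o ∈ C_t, Q) + P(u ∈ C_s, o ∈ C_s, Q)) − P(u ∈ C_s, Q)·P(o ∈ C_s, Q))`
(`μ(o ∈ C_t | 𝓤) ≤ (1 − α)·μ(o ∈ C_t) + α·R`): the cross-cluster instance `bhk_cross_cluster`
supplies the `(1 − α)·μ(o ∈ C_t)` part. -/
theorem psi_of_psiSub (p : E → R) (hp : IsProbVec p) (ends : E → Sym2 V) (s t o u : V)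
    {𝓤 : Set (Set V)} (h𝓤 : IsUpperSet 𝓤)
    (hsub : prob p (clusterInEvent ends s 𝓤 ∩ clusterInEvent ends t {W : Set V | o ∈ W} ∩
          (connEvent ends s t)ᶜ) * prob p (connEvent ends s t)ᶜ *
        prob p (connEvent ends s u ∩ (connEvent ends s t)ᶜ) +
      prob p (clusterInEvent ends s {W : Set V | o ∈ W} ∩ (connEvent ends s t)ᶜ) *
        prob p (clusterInEvent ends s 𝓤 ∩ (connEvent ends s t)ᶜ) *
        prob p (connEvent ends s u ∩ (connEvent ends s t)ᶜ) ≤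
      (prob p (connEvent ends s u ∩ clusterInEvent ends t {W : Set V | o ∈ W} ∩
          (connEvent ends s t)ᶜ) +
        prob p (connEvent ends s u ∩ clusterInEvent ends s {W : Set V | o ∈ W} ∩
          (connEvent ends s t)ᶜ)) * prob p (connEvent ends s t)ᶜ *
        prob p (clusterInEvent ends s 𝓤 ∩ (connEvent ends s t)ᶜ)) :
    prob p (clusterInEvent ends s 𝓤 ∩ clusterInEvent ends t {W : Set V | o ∈ W} ∩
          (connEvent ends s t)ᶜ) * prob p (connEvent ends s t)ᶜ * prob p (connEvent ends s t)ᶜ ≤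
      prob p (clusterInEvent ends s 𝓤 ∩ (connEvent ends s t)ᶜ) *
        ((prob p (connEvent ends s t)ᶜ - prob p (connEvent ends s u ∩ (connEvent ends s t)ᶜ)) *
            prob p (clusterInEvent ends t {W : Set V | o ∈ W} ∩ (connEvent ends s t)ᶜ) +
          prob p (connEvent ends s t)ᶜ *
            (prob p (connEvent ends s u ∩ clusterInEvent ends t {W : Set V | o ∈ W} ∩
                (connEvent ends s t)ᶜ) +
              prob p (connEvent ends s u ∩ clusterInEvent ends s {W : Set V | o ∈ W} ∩
                (connEvent ends s t)ᶜ)) -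
          prob p (connEvent ends s u ∩ (connEvent ends s t)ᶜ) *
            prob p (clusterInEvent ends s {W : Set V | o ∈ W} ∩ (connEvent ends s t)ᶜ)) := by
  have h1 := bhk_cross_cluster p hp ends s t h𝓤 (isUpperSet_memFamily o)
  have hqa : prob p (connEvent ends s u ∩ (connEvent ends s t)ᶜ) ≤
      prob p (connEvent ends s t)ᶜ :=
    prob_mono hp Set.inter_subset_right
  exact psi_algebra hqa h1 hsub

end GenSubCov

end Summit.Ventures.PercRepro2

/-!
## Erratum (p2 g16, 2026-08-27, appended; every declaration above byte-identical)

The module docstring's sentence «Both are census-true (exact max-closure over ALL up-sets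
`𝓤 ⊆ 𝓥` …)» is WRONG as a conjecture: (Ψ-sub′) and (GEN-sub) are FALSE.  Exact witness
(proofs/P2-G16-GENSUB.md §3.6, three independent codes): `n = 6`, edges `(0,3) 9/10`,
`(0,4) 1/20`, `(1,2) 1/20`, `(1,5) 1/10`, `(2,4) 1/10`, `(3,4) 19/20`, `(4,5) 3/10`, `s = 5`,
`t = 3`, `o = 0`, `u = 2`, `𝓤 = {K ⊇ {1, 2}} ⊆ {K ∋ 2}`:
`μ(o ∈ C_t | 1, 2 ∈ C_s) + μ(o ∈ C_s) = 0.9040603… > μ(o ∈ C_s ∪ C_t | 2 ∈ C_s) = 0.9033782…`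
(violation `6.82·10⁻⁴`; on the witness the covariance hypothesis of `psiSub_of_cov_nonneg`
fails, `Cov = −8.4·10⁻⁶`, as it must).  The theorems of this file are conditional and stand.
The statement of record on the sub-up-sets of `{u ∈ ·}` is (Ψ) itself, i.e. the conclusion of
`psi_of_psiSub`, which holds on the witness with margin `6·10⁻⁴`: in the form
«Berkson excess `μ(o ∈ C_t | 𝓤) − μ(o ∈ C_t | u ∈ C_s)` ≤ H-lift + `(1 − α)`·N-rise»
(`α = μ(u ∈ C_s)`, N-rise `= μ(o ∉ C_s ∪ C_t | u ∈ C_s) − μ(o ∉ C_s ∪ C_t)`), the N-rise term is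
exactly what (Ψ-sub′) dropped.
-/
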